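import Summits.QuantumAdvantage.QuantumAdvantage.Theses.LinnikCubicClassGroups
import Summits.QuantumAdvantage.QuantumAdvantage.Theorems.LinnikCubicClassGroupsPureCubicClassGroupFBQPStubCubicGiantStepCycleLoops
import Literature.NumberTheory.CubicFields.PureCubicWalkParams
import Literature.NumberTheory.NumberFields.PureCubicDiscriminantBound

/-!
# Crux `LinnikCubicClassGroups.PureCubicClassGroupFBQP` (stmt-QuantumAdvantage-11544) — stub `stub_cubicGiantStepCycle` (S3b-W1)

Line `arakelov-giant-step-cycle`, stub `stub_cubicGiantStepCycle`: THE CUBIC WALK PROGRAMS CARRY A `GiantStepCycle`.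
Assembly of the abstract half `Literature.Computability.Cryptography.GiantStepCycle.exists_of_chain` with the number
theory of the parts RedSem / Chain / Loops of this stub (`…StubCubicGiantStepCycleRedSem/Chain/Loops.lean`): the MODEL
FIELD `K ∋ θ`, `θ³ = ab²` (hypothesis S4a; signature `(1,1)` by `PureCubic.exists_embeddings_pair`), its Voronoi chain
`ν = voronoiChain σ₁ σ₂ 𝓞_K 1` and filtered enumeration `s` (hypothesis T3a at `I = 𝓞_K`, `x₀ = 1`), `ℓ i = log σ₁ν(i)`,
labels `lab i = cd (s i)` = THE canonical code of `ν(s i)⁻¹𝓞_K` (`exists_chainCodes`, exact repetition with period `nS`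
by T3a + `canon_unique`), the walk facts `cubicWalk_facts`, the numerics `walkParams_bounds` with `|d_K| ≤ 27a²b²`
(`PureCubic.abs_discr_le`, also recorded as the registered sub-goal `stub_cubicGiantStepCycleCore`), the regulator clauses (`R = R_K` for every cubic `K' ∋ ∛(ab²)` by S3c; `log 2/6 ≤ R_K` from
`n₀ log 2 ≤ 6R_K`; `R_K ≤ |d_K|⁶ ≤ (27a²b²)⁶` by T3a′; `nS ≤ n₀`) and the label sizes `chainLabel_bounds`.
-/

-- the problem namespace repeats the summit name (`QuantumAdvantage.QuantumAdvantage`)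
set_option linter.dupNamespace false

namespace Summit.QuantumAdvantage.QuantumAdvantage.Theorems.LinnikCubicClassGroups

open scoped NumberField nonZeroDivisors
open NumberField
open Literature.Computability.Cryptography (GiantStepCycle WalkData IntWalkOps)
open Literature.Computability.Cryptography.CubicClassTable
open Literature.NumberTheory.CubicFields
open Literature.NumberTheory.CubicFields.PureCubicCodes (Mem Canon val canon_unique)
open Literature.NumberTheory.NumberFields.PureCubic

/-- **`stub_cubicGiantStepCycleCore`** (registered sub-goal of this stub): for admissible `(a, b)` and a cubic `K ∋ θ`,
`θ³ = ab²`: `|d_K| ≤ 27a²b²` (`PureCubic.abs_discr_le`) and `K` has a real embedding `σ₁` (with `σ₁ θ = ∛(ab²)`) and a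
non-real embedding `σ₂` (`PureCubic.exists_embeddings_pair`, `real_embedding_apply`). -/
theorem stub_cubicGiantStepCycleCore : ∀ (a b : ℕ), Squarefree (a * b) → a * b ≠ 1 →
    ∀ (K : Type) [Field K] [NumberField K], Module.finrank ℚ K = 3 → ∀ θ : K, θ ^ 3 = ((a * b ^ 2 : ℕ) : K) →
    |NumberField.discr K| ≤ 27 * (a : ℤ) ^ 2 * (b : ℤ) ^ 2 ∧ ∃ (σ₁ : K →+* ℝ) (σ₂ : K →+* ℂ),
      σ₁ θ = ((a * b ^ 2 : ℕ) : ℝ) ^ ((1 : ℝ) / 3) ∧ ∃ z : K, starRingEnd ℂ (σ₂ z) ≠ σ₂ z := by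
  intro a b hab hab1 K _ _ hdeg θ hθ
  obtain ⟨σ₁, σ₂, hσ₂⟩ := exists_embeddings_pair hdeg hab hab1 hθ
  exact ⟨abs_discr_le hdeg hab hab1 hθ, σ₁, σ₂, real_embedding_apply σ₁ hθ, hσ₂⟩

/-- **S3b-W1 `stub_cubicGiantStepCycle`** (registered signature). From T3a, T3a′, B, S4a, S3c and the specifications of
G1–G4, P4: for admissible `(a, b)` and `prec ≥ 4·size(ab) + 8`, the integer walk operations assembled from the programs carry a
`GiantStepCycle` on lattice codes (`L = log(11/10)`, `η = 16/2^prec`, `G = 3 log(27a²b²) + 7`, circumference the regulator of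
every cubic field containing `∛(ab²)`, `log 2/6 ≤ R ≤ (27a²b²)⁶`, `n log 2 ≤ 6R`, canonical labels of denominator and entries
`≤ 243a²b²`). [Voronoi 1896; Buchmann–Williams 1988 §3; Jozsa 2003 §7, §9] -/
theorem stub_cubicGiantStepCycle :
    ∀ (mulE : (ℕ × ℕ) × ((ℤ × ℤ × ℤ × ℕ) × (ℤ × ℤ × ℤ × ℕ)) → ℤ × ℤ × ℤ × ℕ)
      (normE : (ℕ × ℕ) × (ℤ × ℤ × ℤ × ℕ) → ℤ × ℕ)
      (latScale : (ℕ × ℕ) × ((ℕ × List ℤ) × (ℤ × ℤ × ℤ × ℕ)) → ℕ × List ℤ)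
      (latProd : (ℕ × ℕ) × ((ℕ × List ℤ) × (ℕ × List ℤ)) → ℕ × List ℤ)
      (latAddGen : (ℕ × ℕ) × ((ℕ × List ℤ) × (ℤ × ℤ × ℤ × ℕ)) → ℕ × List ℤ)
      (lexE : (ℕ × ℕ) × (ℕ × List ℤ) → ℤ × ℤ × ℤ × ℕ)
      (logE : (ℕ × ℕ) × ((ℤ × ℤ × ℤ × ℕ) × ℕ) → ℤ)
      (ordL : ℕ × ℕ → ℕ × List ℤ)
      (invE : (ℕ × ℕ) × (ℤ × ℤ × ℤ × ℕ) → ℤ × ℤ × ℤ × ℕ)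
      (redL : ((ℕ × ℕ) × ℕ) × (ℕ × List ℤ) → (ℕ × List ℤ) × ℤ)
      (isBigL : (ℕ × ℕ) × (ℕ × List ℤ) → Bool)
      (rhoS : ((ℕ × ℕ) × ℕ) × (ℕ × List ℤ) → (ℕ × List ℤ) × ℤ)
      (starS : ((ℕ × ℕ) × ℕ) × ((ℕ × List ℤ) × (ℕ × List ℤ)) → (ℕ × List ℤ) × ℤ)
      (unitS : (ℕ × ℕ) × ℕ → (ℕ × List ℤ) × ℤ),
    -- T3a
    (∀ (K : Type) [Field K] [NumberField K], Module.finrank ℚ K = 3 →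
    ∀ (σ₁ : K →+* ℝ) (σ₂ : K →+* ℂ), (∃ z : K, starRingEnd ℂ (σ₂ z) ≠ σ₂ z) →
    ∀ (I : FractionalIdeal (𝓞 K)⁰ K), I ≠ 0 → ∀ x₀ : K, x₀ ∈ posRelMinima σ₁ σ₂ I →
    ∃ (s : ℤ → ℤ) (n₀ nS : ℕ) (ε : (𝓞 K)ˣ),
      0 < n₀ ∧ 1 < σ₁ ((ε : 𝓞 K) : K) ∧ Real.log (σ₁ ((ε : 𝓞 K) : K)) = NumberField.Units.regulator K ∧
      (∀ i, voronoiChain σ₁ σ₂ I x₀ (i + n₀) = ((ε : 𝓞 K) : K) * voronoiChain σ₁ σ₂ I x₀ i) ∧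
      (n₀ : ℝ) * Real.log 2 ≤ 6 * NumberField.Units.regulator K ∧
      StrictMono s ∧
      (∀ i, 11 * σ₁ (voronoiChain σ₁ σ₂ I x₀ (s i)) ≤ 10 * σ₁ (voronoiChain σ₁ σ₂ I x₀ (s i + 1))) ∧
      (∀ j, 11 * σ₁ (voronoiChain σ₁ σ₂ I x₀ j) ≤ 10 * σ₁ (voronoiChain σ₁ σ₂ I x₀ (j + 1)) → ∃ i, s i = j) ∧
      0 ≤ s 0 ∧ (∀ j, 0 ≤ j → 11 * σ₁ (voronoiChain σ₁ σ₂ I x₀ j) ≤ 10 * σ₁ (voronoiChain σ₁ σ₂ I x₀ (j + 1)) → s 0 ≤ j) ∧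
      (∀ i, s (i + 1) ≤ s i + 6) ∧
      0 < nS ∧ (∀ i, s (i + nS) = s i + n₀) ∧
      (∀ i, Real.log (11 / 10) ≤
        Real.log (σ₁ (voronoiChain σ₁ σ₂ I x₀ (s (i + 1)))) - Real.log (σ₁ (voronoiChain σ₁ σ₂ I x₀ (s i)))) ∧
      (∀ i, Real.log (σ₁ (voronoiChain σ₁ σ₂ I x₀ (s (i + 1)))) - Real.log (σ₁ (voronoiChain σ₁ σ₂ I x₀ (s i))) ≤
        6 * Real.log (3 * Real.sqrt |(NumberField.discr K : ℝ)|)) ∧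
      (∀ i, (1 : K) ∈ posRelMinima σ₁ σ₂ (FractionalIdeal.spanSingleton (𝓞 K)⁰ (voronoiChain σ₁ σ₂ I x₀ (s i))⁻¹ * I)) ∧
      (∀ i j, FractionalIdeal.spanSingleton (𝓞 K)⁰ (voronoiChain σ₁ σ₂ I x₀ (s i))⁻¹ * I =
          FractionalIdeal.spanSingleton (𝓞 K)⁰ (voronoiChain σ₁ σ₂ I x₀ (s j))⁻¹ * I ↔ (nS : ℤ) ∣ i - j) ∧
      (∀ (i k : ℤ), voronoiChain σ₁ σ₂ (FractionalIdeal.spanSingleton (𝓞 K)⁰ (voronoiChain σ₁ σ₂ I x₀ i)⁻¹ * I) 1 k =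
          (voronoiChain σ₁ σ₂ I x₀ i)⁻¹ * voronoiChain σ₁ σ₂ I x₀ (i + k))) →
    -- T3a′
    (∀ (K : Type) [Field K] [NumberField K], Module.finrank ℚ K = 3 →
    ∀ (σ₁ : K →+* ℝ) (σ₂ : K →+* ℂ), (∃ z : K, starRingEnd ℂ (σ₂ z) ≠ σ₂ z) →
      (∀ (I : FractionalIdeal (𝓞 K)⁰ K), I ≠ 0 →
        ∃ γ : K, γ ∈ I ∧ 0 < σ₁ γ ∧ ‖σ₂ γ‖ < 1 ∧
          (∀ φ : K, φ ∈ I → 0 < σ₁ φ → ‖σ₂ φ‖ < 1 → σ₁ γ ≤ σ₁ φ) ∧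
          (∀ φ : K, φ ∈ I → 0 < σ₁ φ → ‖σ₂ φ‖ < 1 → σ₁ φ ≤ σ₁ γ → φ = γ) ∧
          γ ∈ posRelMinima σ₁ σ₂ I ∧
          (FractionalIdeal.absNorm I : ℝ) < σ₁ γ ∧
          σ₁ γ ≤ 3 * (FractionalIdeal.absNorm I : ℝ) * Real.sqrt |(NumberField.discr K : ℝ)|) ∧
      (∀ (I : FractionalIdeal (𝓞 K)⁰ K) (θ : K), θ ∈ posRelMinima σ₁ σ₂ I →
        (1 : K) ∈ posRelMinima σ₁ σ₂ (FractionalIdeal.spanSingleton (𝓞 K)⁰ θ⁻¹ * I)) ∧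
      (∀ (J : FractionalIdeal (𝓞 K)⁰ K), (1 : K) ∈ posRelMinima σ₁ σ₂ J →
        1 ≤ J ∧ (FractionalIdeal.absNorm J : ℝ) ≤ 1 ∧
          Real.pi / (2 * Real.sqrt |(NumberField.discr K : ℝ)|) ≤ (FractionalIdeal.absNorm J : ℝ)) ∧
      NumberField.Units.regulator K ≤ |(NumberField.discr K : ℝ)| ^ 6) →
    -- B
    (∀ (a b : ℕ), Squarefree (a * b) → a * b ≠ 1 →
      ∀ (K : Type) [Field K] [NumberField K], Module.finrank ℚ K = 3 →
        ∀ θ : K, θ ^ 3 = ((a * b ^ 2 : ℕ) : K) →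
          IsIntegral ℤ θ ∧ IsIntegral ℤ (θ ^ 2 / (b : K)) ∧
          (∀ ξ : 𝓞 K, ∃ c₀ c₁ c₂ : ℤ, (3 : K) * (ξ : K) = c₀ + c₁ * θ + c₂ * (θ ^ 2 / (b : K))) ∧
          (∀ c₀ c₁ c₂ : ℚ, (c₀ : K) + (c₁ : K) * θ + (c₂ : K) * (θ ^ 2 / (b : K)) = 0 → c₀ = 0 ∧ c₁ = 0 ∧ c₂ = 0) ∧
          (∀ x y z : ℚ, Algebra.norm ℚ ((x : K) + (y : K) * θ + (z : K) * (θ ^ 2 / (b : K))) =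
            x ^ 3 + (a * b ^ 2 : ℕ) * y ^ 3 + (a ^ 2 * b : ℕ) * z ^ 3 - 3 * (a * b : ℕ) * x * y * z) ∧
          (∀ x y z : ℚ, Algebra.trace ℚ K ((x : K) + (y : K) * θ + (z : K) * (θ ^ 2 / (b : K))) = 3 * x)) →
    -- S4a (landed `stub_cubicFieldFacts`)
    (∀ m : ℕ, (∀ r : ℕ, r ^ 3 ≠ m) →
      (∃ (K : Type) (_ : Field K) (_ : NumberField K), Module.finrank ℚ K = 3 ∧ ∃ α : K, α ^ 3 = (m : K)) ∧
      ∀ (K : Type) [Field K] [NumberField K], Module.finrank ℚ K = 3 → (∃ α : K, α ^ 3 = (m : K)) →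
        (∀ F : IntermediateField ℚ K, Module.finrank ℚ F ≠ 2) ∧
        |NumberField.discr K| ≤ 27 * (m : ℤ) ^ 2 ∧
        NumberField.classNumber K ≤ (27 * m ^ 2) ^ 10 ∧
        ∀ p : ℕ, p.Prime → {P : Ideal (𝓞 K) | P.IsPrime ∧ Ideal.absNorm P = p}.ncard ≤ 3) →
    -- S3c (landed `stub_admissibleFields`)
    (∀ m : ℕ, (∀ r : ℕ, r ^ 3 ≠ m) →
      ∀ (K : Type) [Field K] [NumberField K] (K' : Type) [Field K'] [NumberField K'],
        Module.finrank ℚ K = 3 → Module.finrank ℚ K' = 3 →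
        ∀ (α : K) (α' : K'), α ^ 3 = (m : K) → α' ^ 3 = (m : K') →
        (∃ e : K ≃ₐ[ℚ] K', e α = α') ∧ NumberField.Units.regulator K = NumberField.Units.regulator K') →
    -- the specifications of G1
    (∀ (a b : ℕ), Squarefree (a * b) → a * b ≠ 1 →
      ∀ (K : Type) [Field K] [NumberField K], Module.finrank ℚ K = 3 →
        ∀ θ : K, θ ^ 3 = ((a * b ^ 2 : ℕ) : K) →
        (∀ c₀ c₁ c₂ : ℚ, (c₀ : K) + (c₁ : K) * θ + (c₂ : K) * (θ ^ 2 / (b : K)) = 0 → c₀ = 0 ∧ c₁ = 0 ∧ c₂ = 0) →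
        -- multiplication of element codes
        (∀ e₁ e₂ : ℤ × ℤ × ℤ × ℕ, 1 ≤ e₁.2.2.2 → 1 ≤ e₂.2.2.2 →
          1 ≤ (mulE ((a, b), (e₁, e₂))).2.2.2 ∧
          (((((mulE ((a, b), (e₁, e₂))).1 : ℤ) : K) + (((mulE ((a, b), (e₁, e₂))).2.1 : ℤ) : K) * θ + (((mulE ((a, b), (e₁, e₂))).2.2.1 : ℤ) : K) * (θ ^ 2 / (b : K))) /
              (((mulE ((a, b), (e₁, e₂))).2.2.2 : ℕ) : K)) =
            (((((e₁).1 : ℤ) : K) + (((e₁).2.1 : ℤ) : K) * θ + (((e₁).2.2.1 : ℤ) : K) * (θ ^ 2 / (b : K))) /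
              (((e₁).2.2.2 : ℕ) : K)) *
            (((((e₂).1 : ℤ) : K) + (((e₂).2.1 : ℤ) : K) * θ + (((e₂).2.2.1 : ℤ) : K) * (θ ^ 2 / (b : K))) /
              (((e₂).2.2.2 : ℕ) : K))) ∧
        -- the norm of an element code, as numerator/denominator
        (∀ e : ℤ × ℤ × ℤ × ℕ, 1 ≤ e.2.2.2 →
          1 ≤ (normE ((a, b), e)).2 ∧
          (((normE ((a, b), e)).1 : ℤ) : ℚ) / (((normE ((a, b), e)).2 : ℕ) : ℚ) =
            Algebra.norm ℚ (((((e).1 : ℤ) : K) + (((e).2.1 : ℤ) : K) * θ + (((e).2.2.1 : ℤ) : K) * (θ ^ 2 / (b : K))) /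
              (((e).2.2.2 : ℕ) : K))) ∧
        -- canonical codes are unique for a given lattice
        (∀ c c' : ℕ × List ℤ, (∃ (h11 h12 h13 h22 h23 h33 : ℤ), (c).2 = [h11, h12, h13, h22, h23, h33] ∧
            0 < h11 ∧ 0 < h22 ∧ 0 < h33 ∧ 0 ≤ h12 ∧ h12 < h22 ∧ 0 ≤ h13 ∧ h13 < h33 ∧ 0 ≤ h23 ∧ h23 < h33 ∧
            1 ≤ (c).1 ∧ Int.gcd ((c).1 : ℤ) (Int.gcd h11 (Int.gcd h12 (Int.gcd h13 (Int.gcd h22 (Int.gcd h23 h33))))) = 1) → (∃ (h11 h12 h13 h22 h23 h33 : ℤ), (c').2 = [h11, h12, h13, h22, h23, h33] ∧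
            0 < h11 ∧ 0 < h22 ∧ 0 < h33 ∧ 0 ≤ h12 ∧ h12 < h22 ∧ 0 ≤ h13 ∧ h13 < h33 ∧ 0 ≤ h23 ∧ h23 < h33 ∧
            1 ≤ (c').1 ∧ Int.gcd ((c').1 : ℤ) (Int.gcd h11 (Int.gcd h12 (Int.gcd h13 (Int.gcd h22 (Int.gcd h23 h33))))) = 1) →
          (∀ φ : K, (∃ (h11 h12 h13 h22 h23 h33 u v w : ℤ), (c).2 = [h11, h12, h13, h22, h23, h33] ∧
            (((c).1 : ℕ) : K) * (φ) = ((u * h11 : ℤ) : K) + ((u * h12 + v * h22 : ℤ) : K) * θ +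
              ((u * h13 + v * h23 + w * h33 : ℤ) : K) * (θ ^ 2 / (b : K))) ↔ (∃ (h11 h12 h13 h22 h23 h33 u v w : ℤ), (c').2 = [h11, h12, h13, h22, h23, h33] ∧
            (((c').1 : ℕ) : K) * (φ) = ((u * h11 : ℤ) : K) + ((u * h12 + v * h22 : ℤ) : K) * θ +
              ((u * h13 + v * h23 + w * h33 : ℤ) : K) * (θ ^ 2 / (b : K)))) → c = c') ∧
        -- lattice × nonzero element
        (∀ (c : ℕ × List ℤ) (e : ℤ × ℤ × ℤ × ℕ), (∃ (h11 h12 h13 h22 h23 h33 : ℤ), (c).2 = [h11, h12, h13, h22, h23, h33] ∧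
            0 < h11 ∧ 0 < h22 ∧ 0 < h33 ∧ 0 ≤ h12 ∧ h12 < h22 ∧ 0 ≤ h13 ∧ h13 < h33 ∧ 0 ≤ h23 ∧ h23 < h33 ∧
            1 ≤ (c).1 ∧ Int.gcd ((c).1 : ℤ) (Int.gcd h11 (Int.gcd h12 (Int.gcd h13 (Int.gcd h22 (Int.gcd h23 h33))))) = 1) → 1 ≤ e.2.2.2 →
          (((((e).1 : ℤ) : K) + (((e).2.1 : ℤ) : K) * θ + (((e).2.2.1 : ℤ) : K) * (θ ^ 2 / (b : K))) /
              (((e).2.2.2 : ℕ) : K)) ≠ 0 →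
          (∃ (h11 h12 h13 h22 h23 h33 : ℤ), (latScale ((a, b), (c, e))).2 = [h11, h12, h13, h22, h23, h33] ∧
            0 < h11 ∧ 0 < h22 ∧ 0 < h33 ∧ 0 ≤ h12 ∧ h12 < h22 ∧ 0 ≤ h13 ∧ h13 < h33 ∧ 0 ≤ h23 ∧ h23 < h33 ∧
            1 ≤ (latScale ((a, b), (c, e))).1 ∧ Int.gcd ((latScale ((a, b), (c, e))).1 : ℤ) (Int.gcd h11 (Int.gcd h12 (Int.gcd h13 (Int.gcd h22 (Int.gcd h23 h33))))) = 1) ∧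
          ∀ φ : K, (∃ (h11 h12 h13 h22 h23 h33 u v w : ℤ), (latScale ((a, b), (c, e))).2 = [h11, h12, h13, h22, h23, h33] ∧
            (((latScale ((a, b), (c, e))).1 : ℕ) : K) * (φ) = ((u * h11 : ℤ) : K) + ((u * h12 + v * h22 : ℤ) : K) * θ +
              ((u * h13 + v * h23 + w * h33 : ℤ) : K) * (θ ^ 2 / (b : K))) ↔
            ∃ ψ : K, (∃ (h11 h12 h13 h22 h23 h33 u v w : ℤ), (c).2 = [h11, h12, h13, h22, h23, h33] ∧
            (((c).1 : ℕ) : K) * (ψ) = ((u * h11 : ℤ) : K) + ((u * h12 + v * h22 : ℤ) : K) * θ +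
              ((u * h13 + v * h23 + w * h33 : ℤ) : K) * (θ ^ 2 / (b : K))) ∧ φ = ψ * (((((e).1 : ℤ) : K) + (((e).2.1 : ℤ) : K) * θ + (((e).2.2.1 : ℤ) : K) * (θ ^ 2 / (b : K))) /
              (((e).2.2.2 : ℕ) : K))) ∧
        -- lattice × lattice (the ℤ-span of the products)
        (∀ c₁ c₂ : ℕ × List ℤ, (∃ (h11 h12 h13 h22 h23 h33 : ℤ), (c₁).2 = [h11, h12, h13, h22, h23, h33] ∧
            0 < h11 ∧ 0 < h22 ∧ 0 < h33 ∧ 0 ≤ h12 ∧ h12 < h22 ∧ 0 ≤ h13 ∧ h13 < h33 ∧ 0 ≤ h23 ∧ h23 < h33 ∧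
            1 ≤ (c₁).1 ∧ Int.gcd ((c₁).1 : ℤ) (Int.gcd h11 (Int.gcd h12 (Int.gcd h13 (Int.gcd h22 (Int.gcd h23 h33))))) = 1) → (∃ (h11 h12 h13 h22 h23 h33 : ℤ), (c₂).2 = [h11, h12, h13, h22, h23, h33] ∧
            0 < h11 ∧ 0 < h22 ∧ 0 < h33 ∧ 0 ≤ h12 ∧ h12 < h22 ∧ 0 ≤ h13 ∧ h13 < h33 ∧ 0 ≤ h23 ∧ h23 < h33 ∧
            1 ≤ (c₂).1 ∧ Int.gcd ((c₂).1 : ℤ) (Int.gcd h11 (Int.gcd h12 (Int.gcd h13 (Int.gcd h22 (Int.gcd h23 h33))))) = 1) →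
          (∃ (h11 h12 h13 h22 h23 h33 : ℤ), (latProd ((a, b), (c₁, c₂))).2 = [h11, h12, h13, h22, h23, h33] ∧
            0 < h11 ∧ 0 < h22 ∧ 0 < h33 ∧ 0 ≤ h12 ∧ h12 < h22 ∧ 0 ≤ h13 ∧ h13 < h33 ∧ 0 ≤ h23 ∧ h23 < h33 ∧
            1 ≤ (latProd ((a, b), (c₁, c₂))).1 ∧ Int.gcd ((latProd ((a, b), (c₁, c₂))).1 : ℤ) (Int.gcd h11 (Int.gcd h12 (Int.gcd h13 (Int.gcd h22 (Int.gcd h23 h33))))) = 1) ∧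
          ∀ φ : K, (∃ (h11 h12 h13 h22 h23 h33 u v w : ℤ), (latProd ((a, b), (c₁, c₂))).2 = [h11, h12, h13, h22, h23, h33] ∧
            (((latProd ((a, b), (c₁, c₂))).1 : ℕ) : K) * (φ) = ((u * h11 : ℤ) : K) + ((u * h12 + v * h22 : ℤ) : K) * θ +
              ((u * h13 + v * h23 + w * h33 : ℤ) : K) * (θ ^ 2 / (b : K))) ↔
            φ ∈ AddSubgroup.closure {ψ : K | ∃ ψ₁ ψ₂ : K, (∃ (h11 h12 h13 h22 h23 h33 u v w : ℤ), (c₁).2 = [h11, h12, h13, h22, h23, h33] ∧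
            (((c₁).1 : ℕ) : K) * (ψ₁) = ((u * h11 : ℤ) : K) + ((u * h12 + v * h22 : ℤ) : K) * θ +
              ((u * h13 + v * h23 + w * h33 : ℤ) : K) * (θ ^ 2 / (b : K))) ∧ (∃ (h11 h12 h13 h22 h23 h33 u v w : ℤ), (c₂).2 = [h11, h12, h13, h22, h23, h33] ∧
            (((c₂).1 : ℕ) : K) * (ψ₂) = ((u * h11 : ℤ) : K) + ((u * h12 + v * h22 : ℤ) : K) * θ +
              ((u * h13 + v * h23 + w * h33 : ℤ) : K) * (θ ^ 2 / (b : K))) ∧ ψ = ψ₁ * ψ₂}) ∧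
        -- lattice + one generator
        (∀ (c : ℕ × List ℤ) (e : ℤ × ℤ × ℤ × ℕ), (∃ (h11 h12 h13 h22 h23 h33 : ℤ), (c).2 = [h11, h12, h13, h22, h23, h33] ∧
            0 < h11 ∧ 0 < h22 ∧ 0 < h33 ∧ 0 ≤ h12 ∧ h12 < h22 ∧ 0 ≤ h13 ∧ h13 < h33 ∧ 0 ≤ h23 ∧ h23 < h33 ∧
            1 ≤ (c).1 ∧ Int.gcd ((c).1 : ℤ) (Int.gcd h11 (Int.gcd h12 (Int.gcd h13 (Int.gcd h22 (Int.gcd h23 h33))))) = 1) → 1 ≤ e.2.2.2 →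
          (∃ (h11 h12 h13 h22 h23 h33 : ℤ), (latAddGen ((a, b), (c, e))).2 = [h11, h12, h13, h22, h23, h33] ∧
            0 < h11 ∧ 0 < h22 ∧ 0 < h33 ∧ 0 ≤ h12 ∧ h12 < h22 ∧ 0 ≤ h13 ∧ h13 < h33 ∧ 0 ≤ h23 ∧ h23 < h33 ∧
            1 ≤ (latAddGen ((a, b), (c, e))).1 ∧ Int.gcd ((latAddGen ((a, b), (c, e))).1 : ℤ) (Int.gcd h11 (Int.gcd h12 (Int.gcd h13 (Int.gcd h22 (Int.gcd h23 h33))))) = 1) ∧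
          ∀ φ : K, (∃ (h11 h12 h13 h22 h23 h33 u v w : ℤ), (latAddGen ((a, b), (c, e))).2 = [h11, h12, h13, h22, h23, h33] ∧
            (((latAddGen ((a, b), (c, e))).1 : ℕ) : K) * (φ) = ((u * h11 : ℤ) : K) + ((u * h12 + v * h22 : ℤ) : K) * θ +
              ((u * h13 + v * h23 + w * h33 : ℤ) : K) * (θ ^ 2 / (b : K))) ↔
            ∃ (ψ : K) (k : ℤ), (∃ (h11 h12 h13 h22 h23 h33 u v w : ℤ), (c).2 = [h11, h12, h13, h22, h23, h33] ∧
            (((c).1 : ℕ) : K) * (ψ) = ((u * h11 : ℤ) : K) + ((u * h12 + v * h22 : ℤ) : K) * θ +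
              ((u * h13 + v * h23 + w * h33 : ℤ) : K) * (θ ^ 2 / (b : K))) ∧ φ = ψ + (k : K) * (((((e).1 : ℤ) : K) + (((e).2.1 : ℤ) : K) * θ + (((e).2.2.1 : ℤ) : K) * (θ ^ 2 / (b : K))) /
              (((e).2.2.2 : ℕ) : K)))) →
    -- the specification of G2
    (∀ (a b : ℕ), Squarefree (a * b) → a * b ≠ 1 →
      ∀ (K : Type) [Field K] [NumberField K], Module.finrank ℚ K = 3 →
        ∀ θ : K, θ ^ 3 = ((a * b ^ 2 : ℕ) : K) →
        ∀ (σ₁ : K →+* ℝ) (σ₂ : K →+* ℂ), (∃ z : K, starRingEnd ℂ (σ₂ z) ≠ σ₂ z) →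
        ∀ c : ℕ × List ℤ, (∃ (h11 h12 h13 h22 h23 h33 : ℤ), (c).2 = [h11, h12, h13, h22, h23, h33] ∧
            0 < h11 ∧ 0 < h22 ∧ 0 < h33 ∧ 0 ≤ h12 ∧ h12 < h22 ∧ 0 ≤ h13 ∧ h13 < h33 ∧ 0 ≤ h23 ∧ h23 < h33 ∧
            1 ≤ (c).1 ∧ Int.gcd ((c).1 : ℤ) (Int.gcd h11 (Int.gcd h12 (Int.gcd h13 (Int.gcd h22 (Int.gcd h23 h33))))) = 1) →
          (∃ I : FractionalIdeal (𝓞 K)⁰ K, I ≠ 0 ∧ ∀ φ : K, (∃ (h11 h12 h13 h22 h23 h33 u v w : ℤ), (c).2 = [h11, h12, h13, h22, h23, h33] ∧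
            (((c).1 : ℕ) : K) * (φ) = ((u * h11 : ℤ) : K) + ((u * h12 + v * h22 : ℤ) : K) * θ +
              ((u * h13 + v * h23 + w * h33 : ℤ) : K) * (θ ^ 2 / (b : K))) ↔ φ ∈ I) →
          1 ≤ (lexE ((a, b), c)).2.2.2 ∧
          (∃ (h11 h12 h13 h22 h23 h33 u v w : ℤ), (c).2 = [h11, h12, h13, h22, h23, h33] ∧
            (((c).1 : ℕ) : K) * ((((((lexE ((a, b), c)).1 : ℤ) : K) + (((lexE ((a, b), c)).2.1 : ℤ) : K) * θ + (((lexE ((a, b), c)).2.2.1 : ℤ) : K) * (θ ^ 2 / (b : K))) /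
              (((lexE ((a, b), c)).2.2.2 : ℕ) : K))) = ((u * h11 : ℤ) : K) + ((u * h12 + v * h22 : ℤ) : K) * θ +
              ((u * h13 + v * h23 + w * h33 : ℤ) : K) * (θ ^ 2 / (b : K))) ∧
          0 < σ₁ (((((lexE ((a, b), c)).1 : ℤ) : K) + (((lexE ((a, b), c)).2.1 : ℤ) : K) * θ + (((lexE ((a, b), c)).2.2.1 : ℤ) : K) * (θ ^ 2 / (b : K))) /
              (((lexE ((a, b), c)).2.2.2 : ℕ) : K)) ∧
          ‖σ₂ (((((lexE ((a, b), c)).1 : ℤ) : K) + (((lexE ((a, b), c)).2.1 : ℤ) : K) * θ + (((lexE ((a, b), c)).2.2.1 : ℤ) : K) * (θ ^ 2 / (b : K))) /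
              (((lexE ((a, b), c)).2.2.2 : ℕ) : K))‖ < 1 ∧
          ∀ φ : K, (∃ (h11 h12 h13 h22 h23 h33 u v w : ℤ), (c).2 = [h11, h12, h13, h22, h23, h33] ∧
            (((c).1 : ℕ) : K) * (φ) = ((u * h11 : ℤ) : K) + ((u * h12 + v * h22 : ℤ) : K) * θ +
              ((u * h13 + v * h23 + w * h33 : ℤ) : K) * (θ ^ 2 / (b : K))) → 0 < σ₁ φ → ‖σ₂ φ‖ < 1 →
            σ₁ (((((lexE ((a, b), c)).1 : ℤ) : K) + (((lexE ((a, b), c)).2.1 : ℤ) : K) * θ + (((lexE ((a, b), c)).2.2.1 : ℤ) : K) * (θ ^ 2 / (b : K))) /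
              (((lexE ((a, b), c)).2.2.2 : ℕ) : K)) ≤ σ₁ φ) →
    -- the specification of G3
    (∀ (a b : ℕ), 1 ≤ a → 1 ≤ b → ∀ (e : ℤ × ℤ × ℤ × ℕ) (prec : ℕ), 1 ≤ e.2.2.2 →
        (1 : ℝ) / 2 ^ prec ≤ ((((e).1 : ℤ) : ℝ) + (((e).2.1 : ℤ) : ℝ) * (((a * b ^ 2 : ℕ) : ℝ) ^ ((1 : ℝ) / 3)) +
              (((e).2.2.1 : ℤ) : ℝ) * (((a ^ 2 * b : ℕ) : ℝ) ^ ((1 : ℝ) / 3))) / (((e).2.2.2 : ℕ) : ℝ) →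
        |((logE ((a, b), (e, prec)) : ℤ) : ℝ) - 2 ^ prec * Real.log (((((e).1 : ℤ) : ℝ) + (((e).2.1 : ℤ) : ℝ) * (((a * b ^ 2 : ℕ) : ℝ) ^ ((1 : ℝ) / 3)) +
              (((e).2.2.1 : ℤ) : ℝ) * (((a ^ 2 * b : ℕ) : ℝ) ^ ((1 : ℝ) / 3))) / (((e).2.2.2 : ℕ) : ℝ))| ≤ 1) →
    -- the specification of G4
    (∀ (a b : ℕ), Squarefree (a * b) → a * b ≠ 1 →
      ∀ (K : Type) [Field K] [NumberField K], Module.finrank ℚ K = 3 →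
        ∀ θ : K, θ ^ 3 = ((a * b ^ 2 : ℕ) : K) →
        (∃ (h11 h12 h13 h22 h23 h33 : ℤ), (ordL (a, b)).2 = [h11, h12, h13, h22, h23, h33] ∧
            0 < h11 ∧ 0 < h22 ∧ 0 < h33 ∧ 0 ≤ h12 ∧ h12 < h22 ∧ 0 ≤ h13 ∧ h13 < h33 ∧ 0 ≤ h23 ∧ h23 < h33 ∧
            1 ≤ (ordL (a, b)).1 ∧ Int.gcd ((ordL (a, b)).1 : ℤ) (Int.gcd h11 (Int.gcd h12 (Int.gcd h13 (Int.gcd h22 (Int.gcd h23 h33))))) = 1) ∧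
        ∀ φ : K, (∃ (h11 h12 h13 h22 h23 h33 u v w : ℤ), (ordL (a, b)).2 = [h11, h12, h13, h22, h23, h33] ∧
            (((ordL (a, b)).1 : ℕ) : K) * (φ) = ((u * h11 : ℤ) : K) + ((u * h12 + v * h22 : ℤ) : K) * θ +
              ((u * h13 + v * h23 + w * h33 : ℤ) : K) * (θ ^ 2 / (b : K))) ↔ IsIntegral ℤ φ) →
    -- the specifications of P4
    (∀ (a b : ℕ), Squarefree (a * b) → a * b ≠ 1 →
        ∀ (K : Type) [Field K] [NumberField K], Module.finrank ℚ K = 3 →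
          ∀ θ : K, θ ^ 3 = ((a * b ^ 2 : ℕ) : K) →
          (∀ e : ℤ × ℤ × ℤ × ℕ, 1 ≤ e.2.2.2 → (((((e).1 : ℤ) : K) + (((e).2.1 : ℤ) : K) * θ + (((e).2.2.1 : ℤ) : K) * (θ ^ 2 / (b : K))) /
              (((e).2.2.2 : ℕ) : K)) ≠ 0 →
            1 ≤ (invE ((a, b), e)).2.2.2 ∧
            (((((invE ((a, b), e)).1 : ℤ) : K) + (((invE ((a, b), e)).2.1 : ℤ) : K) * θ + (((invE ((a, b), e)).2.2.1 : ℤ) : K) * (θ ^ 2 / (b : K))) /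
              (((invE ((a, b), e)).2.2.2 : ℕ) : K)) *
              (((((e).1 : ℤ) : K) + (((e).2.1 : ℤ) : K) * θ + (((e).2.2.1 : ℤ) : K) * (θ ^ 2 / (b : K))) /
              (((e).2.2.2 : ℕ) : K)) = 1) ∧
          (∀ (prec : ℕ) (c : ℕ × List ℤ), 1 ≤ (lexE ((a, b), c)).2.2.2 → (((((lexE ((a, b), c)).1 : ℤ) : K) + (((lexE ((a, b), c)).2.1 : ℤ) : K) * θ + (((lexE ((a, b), c)).2.2.1 : ℤ) : K) * (θ ^ 2 / (b : K))) /
              (((lexE ((a, b), c)).2.2.2 : ℕ) : K)) ≠ 0 →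
            (redL (((a, b), prec), c)).1 = latScale ((a, b), (c, invE ((a, b), lexE ((a, b), c)))) ∧
            (redL (((a, b), prec), c)).2 = logE ((a, b), (lexE ((a, b), c), prec))) ∧
          (∀ c : ℕ × List ℤ, 1 ≤ (lexE ((a, b), c)).2.2.2 →
            (isBigL ((a, b), c) = true ↔
              0 ≤ Algebra.norm ℚ ((10 : K) * (((((lexE ((a, b), c)).1 : ℤ) : K) + (((lexE ((a, b), c)).2.1 : ℤ) : K) * θ + (((lexE ((a, b), c)).2.2.1 : ℤ) : K) * (θ ^ 2 / (b : K))) /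
              (((lexE ((a, b), c)).2.2.2 : ℕ) : K)) - 11)))) ∧
      -- operational specifications (the filtered baby step, the filtered giant step, the first S-point)
      (∀ (a b prec : ℕ) (c : ℕ × List ℤ), rhoS (((a, b), prec), c) =
        (((fun s : ((ℕ × List ℤ) × ℤ) × Bool => if s.2 = true then s else
            (((redL (((a, b), prec), s.1.1)).1, s.1.2 + (redL (((a, b), prec), s.1.1)).2), isBigL ((a, b), (redL (((a, b), prec), s.1.1)).1))))^[7]
          ((c, 0), false)).1) ∧
      (∀ (a b prec : ℕ) (c₁ c₂ : ℕ × List ℤ), starS (((a, b), prec), (c₁, c₂)) =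
        (((fun s : ((ℕ × List ℤ) × ℤ) × Bool => if s.2 = true then s else
            (((redL (((a, b), prec), s.1.1)).1, s.1.2 + (redL (((a, b), prec), s.1.1)).2), isBigL ((a, b), (redL (((a, b), prec), s.1.1)).1))))^[6]
          (((redL (((a, b), prec), latProd ((a, b), (c₁, c₂)))).1, (redL (((a, b), prec), latProd ((a, b), (c₁, c₂)))).2),
            isBigL ((a, b), (redL (((a, b), prec), latProd ((a, b), (c₁, c₂)))).1))).1) ∧
      (∀ (a b prec : ℕ), unitS ((a, b), prec) =
        (((fun s : ((ℕ × List ℤ) × ℤ) × Bool => if s.2 = true then s else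
            (((redL (((a, b), prec), s.1.1)).1, s.1.2 + (redL (((a, b), prec), s.1.1)).2), isBigL ((a, b), (redL (((a, b), prec), s.1.1)).1))))^[6]
          ((ordL (a, b), 0), isBigL ((a, b), ordL (a, b)))).1) →
    ∀ (a b : ℕ), Squarefree (a * b) → a * b ≠ 1 → ∀ prec : ℕ, 4 * Nat.size (a * b) + 8 ≤ prec →
      ∃ G : GiantStepCycle (ℕ × List ℤ),
        G.toWalkData = IntWalkOps.toWalkData
          (⟨fun d => (unitS d).1, fun d c => (rhoS (d, c)).1, fun d c₁ c₂ => (starS (d, (c₁, c₂))).1,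
          fun d c => (rhoS (d, c)).2,
          fun d c₁ c₂ => max (-((2 ^ d.2 * (10 * Nat.size (d.1.1 * d.1.2) + 48) : ℕ) : ℤ)) (min (((2 ^ d.2 * (10 * Nat.size (d.1.1 * d.1.2) + 48) : ℕ) : ℤ)) ((starS (d, (c₁, c₂))).2 + (unitS d).2)),
          fun d => 2 ^ d.2 * (10 * Nat.size (d.1.1 * d.1.2) + 48), fun d => d.2⟩ : IntWalkOps ((ℕ × ℕ) × ℕ) (ℕ × List ℤ)) ((a, b), prec) ∧
        G.L = Real.log (11 / 10) ∧ G.η = 16 / 2 ^ prec ∧ G.G = 3 * Real.log (27 * (a : ℝ) ^ 2 * (b : ℝ) ^ 2) + 7 ∧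
        (∀ (K : Type) [Field K] [NumberField K], Module.finrank ℚ K = 3 →
          ∀ θ : K, θ ^ 3 = ((a * b ^ 2 : ℕ) : K) → G.R = NumberField.Units.regulator K) ∧
        Real.log 2 / 6 ≤ G.R ∧ G.R ≤ (27 * (a : ℝ) ^ 2 * (b : ℝ) ^ 2) ^ 6 ∧ (G.n : ℝ) * Real.log 2 ≤ 6 * G.R ∧
        (∀ m : ℤ, (∃ (h11 h12 h13 h22 h23 h33 : ℤ), (G.lab m).2 = [h11, h12, h13, h22, h23, h33] ∧
            0 < h11 ∧ 0 < h22 ∧ 0 < h33 ∧ 0 ≤ h12 ∧ h12 < h22 ∧ 0 ≤ h13 ∧ h13 < h33 ∧ 0 ≤ h23 ∧ h23 < h33 ∧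
            1 ≤ (G.lab m).1 ∧ Int.gcd ((G.lab m).1 : ℤ) (Int.gcd h11 (Int.gcd h12 (Int.gcd h13 (Int.gcd h22 (Int.gcd h23 h33))))) = 1) ∧
          (G.lab m).1 ≤ 243 * a ^ 2 * b ^ 2 ∧ ∀ h ∈ (G.lab m).2, 0 ≤ h ∧ h ≤ 243 * (a : ℤ) ^ 2 * (b : ℤ) ^ 2) := by
  intro mulE normE latScale latProd latAddGen lexE logE ordL invE redL isBigL rhoS starS unitS hT3a hT3a' hB hS4a hS3c
    hG1 hG2 hG3 hG4 hP4 a b hab hab1 prec hprec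
  obtain ⟨ha0, hb0⟩ := ne_zero_of_squarefree_mul hab
  have hm : ∀ r : ℕ, r ^ 3 ≠ a * b ^ 2 := not_cube hab hab1
  -- the model field and its embeddings
  obtain ⟨K, _, _, hdeg, θ, hθ⟩ := (hS4a (a * b ^ 2) hm).1
  obtain ⟨σ₁, σ₂, hσ₂⟩ := exists_embeddings_pair hdeg hab hab1 hθ
  -- the specifications at `K`
  obtain ⟨-, -, -, hind, -, -⟩ := hB a b hab hab1 K hdeg θ hθ
  obtain ⟨-, -, -, hscale, hprod, -⟩ := hG1 a b hab hab1 K hdeg θ hθ hind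
  have hlex : LexMinSpec a b K θ σ₁ σ₂ lexE := hG2 a b hab hab1 K hdeg θ hθ σ₁ σ₂ hσ₂
  have hlogS : LogSpec a b logE := hG3 a b (Nat.one_le_iff_ne_zero.mpr ha0) (Nat.one_le_iff_ne_zero.mpr hb0)
  have hord : OrdSpec a b K θ ordL := hG4 a b hab hab1 K hdeg θ hθ
  have hscale' : ScaleSpec a b K θ latScale := hscale
  have hprod' : ProdSpec a b K θ latProd := hprod
  obtain ⟨hP4alg, hrho, hstar, hunit⟩ := hP4
  obtain ⟨hinv, hred, hbig⟩ := hP4alg a b hab hab1 K hdeg θ hθ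
  have hinv' : InvSpec a b K θ invE := hinv
  have hred' : RedLEq a b K θ lexE logE invE latScale redL := hred
  have hbig' : IsBigEq a b K θ lexE isBigL := hbig
  have hrho' : RhoSEq redL isBigL rhoS := hrho
  have hstar' : StarSEq redL isBigL latProd starS := hstar
  have hunit' : UnitSEq redL isBigL ordL unitS := hunit
  -- the filtered chain of `𝓞_K` through `1` (T3a)
  have hone : (1 : K) ∈ posRelMinima σ₁ σ₂ (1 : FractionalIdeal (𝓞 K)⁰ K) := one_mem_posRelMinima_one hdeg hσ₂
  obtain ⟨s, n₀, nS, ε, hn₀, hε, hreg, hper, hn₀R, hsm, hbigS, hsurj, hs0, hs0min, h6, hnS, hsper, hgapL, hgapG, -,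
    hJper, -⟩ := hT3a K hdeg σ₁ σ₂ hσ₂ 1 one_ne_zero 1 hone
  have hε' : 1 < σ₁ (algebraMap (𝓞 K) K ε) := hε
  have hreg' : Real.log (σ₁ (algebraMap (𝓞 K) K ε)) = Units.regulator K := hreg
  have hper' : ∀ i, voronoiChain σ₁ σ₂ (1 : FractionalIdeal (𝓞 K)⁰ K) (1 : K) (i + n₀) =
      algebraMap (𝓞 K) K ε * voronoiChain σ₁ σ₂ (1 : FractionalIdeal (𝓞 K)⁰ K) (1 : K) i := hper
  have hνmem := fun i => voronoiChain_mem hdeg hσ₂ ε hε' hone i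
  have hpos : ∀ i, 0 < σ₁ (voronoiChain σ₁ σ₂ (1 : FractionalIdeal (𝓞 K)⁰ K) (1 : K) i) := fun i => (hνmem i).2
  -- the codes of the reduced ideals along the chain
  obtain ⟨cd, hcd⟩ := exists_chainCodes a b hab hab1 K hdeg θ hθ σ₁ σ₂ hσ₂ ε hε' lexE logE invE latScale ordL redL isBigL
    hlex hlogS hinv' hscale' hord hred' hbig' n₀ hn₀ ε hper'
  -- numerics
  have hd0 : 0 < |(discr K : ℝ)| := by rw [← Int.cast_abs]; exact_mod_cast abs_pos.mpr (discr_ne_zero K)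
  have hd27 : |(discr K : ℝ)| ≤ 27 * (a : ℝ) ^ 2 * (b : ℝ) ^ 2 := by
    have h := abs_discr_le hdeg hab hab1 hθ
    have h' : ((|discr K| : ℤ) : ℝ) ≤ ((27 * (a : ℤ) ^ 2 * (b : ℤ) ^ 2 : ℤ) : ℝ) := by exact_mod_cast h
    push_cast [Int.cast_abs] at h'
    exact h'
  obtain ⟨hp9, hdp, hKInt, hG6, hlabA, hlabB⟩ := walkParams_bounds ha0 hb0 hprec hd0 hd27
  -- the walk facts
  obtain ⟨hwu, hwrho1, hwrho2, hwstar⟩ := cubicWalk_facts a b hab hab1 K hdeg θ hθ σ₁ σ₂ hσ₂ ε hε' lexE logE invE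
    latScale latProd ordL redL isBigL rhoS starS unitS hlex hlogS hinv' hscale' hprod' hord hred' hbig' hrho' hstar' hunit'
    cd hcd s n₀ nS hsm hbigS hsurj hs0 hs0min h6 hn₀ hsper prec hdp
  -- labels repeat exactly with the period
  have hlab : ∀ i j, cd (s i) = cd (s j) ↔ (nS : ℤ) ∣ i - j := by
    intro i j
    rw [← hJper i j]
    constructor
    · intro h
      ext φ
      rw [← (hcd (s i)).2 φ, ← (hcd (s j)).2 φ, h]
    · intro h
      exact chainCode_unique hdeg hab hab1 hθ (hcd (s i)).1 (hcd (s j)).1 (hcd (s i)).2 (fun φ => by rw [h]; exact (hcd (s j)).2 φ)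
  -- the abstract half
  obtain ⟨C, hCW, hCL, hCη, hCG, hCR, hCn, hClab, -⟩ := GiantStepCycle.exists_of_chain
    (⟨fun d => (unitS d).1, fun d c => (rhoS (d, c)).1, fun d c₁ c₂ => (starS (d, (c₁, c₂))).1,
      fun d c => (rhoS (d, c)).2,
      fun d c₁ c₂ => max (-((2 ^ d.2 * (10 * Nat.size (d.1.1 * d.1.2) + 48) : ℕ) : ℤ))
        (min (((2 ^ d.2 * (10 * Nat.size (d.1.1 * d.1.2) + 48) : ℕ) : ℤ)) ((starS (d, (c₁, c₂))).2 + (unitS d).2)),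
      fun d => 2 ^ d.2 * (10 * Nat.size (d.1.1 * d.1.2) + 48), fun d => d.2⟩ : IntWalkOps ((ℕ × ℕ) × ℕ) (ℕ × List ℤ))
    ((a, b), prec) (fun i => Real.log (σ₁ (voronoiChain σ₁ σ₂ (1 : FractionalIdeal (𝓞 K)⁰ K) (1 : K) i))) s n₀ nS
    (Units.regulator K) (3 * Real.log (27 * (a : ℝ) ^ 2 * (b : ℝ) ^ 2) + 7) (fun i => cd (s i))
    (fun c₁ c₂ => (starS (((a, b), prec), (c₁, c₂))).2 + (unitS ((a, b), prec)).2)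
    (fun i j hij => Real.log_lt_log (hpos i) (voronoiChain_strictMono hdeg hσ₂ ε hε' hone hij))
    (fun i => by
      show Real.log (σ₁ (voronoiChain σ₁ σ₂ (1 : FractionalIdeal (𝓞 K)⁰ K) (1 : K) (i + n₀))) =
        Real.log (σ₁ (voronoiChain σ₁ σ₂ (1 : FractionalIdeal (𝓞 K)⁰ K) (1 : K) i)) + Units.regulator K
      rw [hper' i, map_mul, Real.log_mul (by linarith) (hpos i).ne', hreg', add_comm])
    hsm hnS hsper hlab hwu hwrho1 hwrho2 (fun _ _ => rfl)
    (fun i₁ i₂ => by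
      obtain ⟨i, h1, h2, h3⟩ := hwstar i₁ i₂
      refine ⟨i, h1, h2, le_trans ?_ hKInt⟩
      have h2p : (0 : ℝ) < 2 ^ prec := by positivity
      show (2 : ℝ) ^ prec * _ + 2 ^ prec ≤ _
      nlinarith)
    hgapL (fun i => (hgapG i).trans hG6) hp9
  refine ⟨C, hCW, hCL, hCη, hCG, fun K' _ _ hdeg' θ' hθ' => ?_, ?_, ?_, ?_, fun m => ?_⟩
  · rw [hCR]; exact (hS3c (a * b ^ 2) hm K K' hdeg hdeg' θ θ' hθ hθ').2
  · rw [hCR]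
    have h1 : (1 : ℝ) ≤ n₀ := by exact_mod_cast hn₀
    have hl2 : 0 < Real.log 2 := Real.log_pos (by norm_num)
    nlinarith
  · rw [hCR]
    exact (hT3a' K hdeg σ₁ σ₂ hσ₂).2.2.2.trans (pow_le_pow_left₀ (abs_nonneg _) hd27 6)
  · rw [hCR, hCn]
    have hle : (nS : ℤ) ≤ n₀ := by
      have key : ∀ n : ℕ, s 0 + n ≤ s (0 + n) := fun n => by
        induction n with
        | zero => simp
        | succ n ih =>
          have h := hsm (show (0 : ℤ) + n < 0 + (n + 1 : ℕ) by push_cast; linarith)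
          push_cast at h ⊢
          linarith
      have h := key nS; rw [hsper 0] at h; linarith
    have hle' : (nS : ℝ) ≤ n₀ := by exact_mod_cast hle
    have hl2 : 0 < Real.log 2 := Real.log_pos (by norm_num)
    nlinarith
  · rw [hClab m]
    exact ⟨(hcd (s m)).1, chainLabel_bounds hdeg hσ₂ ε hε' hab hab1 hθ (hlabA.trans hlabB) (hcd (s m)).1 (s m) (hcd (s m)).2⟩

end Summit.QuantumAdvantage.QuantumAdvantage.Theorems.LinnikCubicClassGroups
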